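import Summits.Langlands.Langlands.Theorems.ParityBlindBianchiTwoAdicBianchiProModularityLevelFiniteIndexLevelChange
import Literature.NumberTheory.Automorphic.PrincipalPowerTowerLevels
import Literature.NumberTheory.Automorphic.BorelStabilizerLattice
import Literature.NumberTheory.Automorphic.GLnAdelicStructureProofs
import HarnessLib

/-!
# `TwoAdicBianchiProModularityLevel` (crux stmt-Langlands-15110, route `ParityBlindBianchi`) —
# TAME-LEVEL MONOTONICITY: the conclusion of stub B / of the crux persists to every smaller tame level

The adelic plumbing that makes the finite-index level change (`…FiniteIndexLevelChange`) unconditional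
for the crux's literal towers `s ↦ U ∩ K_f((2)^s)` (`LevelTower.ofSeq U (K((2)^·).map sndHom)`):

* `ofLocal_mem_of_goodClause` — the crux's third level clause ("`U` contains every integral `g` trivial
  at the bad places") makes `U` HYPERSPECIAL at every good place `v`: `ι_v(GL₂(𝒪_v)) ≤ U`;
* `isUnramifiedLevel_cruxLevel` — hence every level `U ∩ K_f((2)^s)` (`U ≤ GL₂(𝒪̂_K)`) is unramified at
  the good places (`2 ∈ S₀`, so `v ∤ (2)^s`; Literature `IsUnramifiedLevel`,
  `isUnramifiedLevel_inf_comap_principalCongruenceLevel`), so that for `U' ≤ U` the good double cosets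
  `(U' ∩ K_f(2^s)) t_{v,i} (U' ∩ K_f(2^s))` and `(U ∩ K_f(2^s)) t_{v,i} (U ∩ K_f(2^s))` correspond
  single coset by single coset (`IsUnramifiedLevel.bijOn_quotientMapOfLE`) and are finite (compact open
  levels); and the indices `[U ∩ K_f(2^s) : U' ∩ K_f(2^s)]` are all `≤ [U : U'] < ∞` (`U` compact,
  `U'` open);
* `crux_isHeckePoint_of_le_tameLevel` (registered sub-goal) — **for open `U' ≤ U ≤ GL₂(𝒪̂_K)` with `U'`
  hyperspecial at the good places (third clause), Hecke data `a` that are a `ℤ̄₂`-point of `Spf 𝕋(U²)`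
  of the `2`-power Bianchi tower are a point of `Spf 𝕋(U'²)`** — unconditionally, all finite indices;
* `artinLift_conclusion_inf` (registered sub-goal) — **the conclusion block of stub B (= of the crux,
  for fixed `ϖ, a`) at level `U` implies the same block at level `U ∩ V` for every open `V` satisfying
  the third clause.**  So "`∃ U` free over `S₀`" in B and in E2′ means: the level may be taken inside
  ANY prescribed open subgroup hyperspecial at the good places — below the level `U₀` of B's hypothesis,
  as deep as any `R = 𝕋` theorem wants at the places of `S₀` (odd or over `2`), at no cost; B is
  literally "big `R = 𝕋_𝔪` at every sufficiently small fixed tame level, read at the Artin point".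

Sorry-free, definition-free; lead c11 (line `Sketch`, cycle 12).
-/

noncomputable section

set_option linter.dupNamespace false

namespace Summit.Langlands.Langlands.Theorems.TwoAdicBianchiProModularityLevel

open CategoryTheory Literature.NumberTheory.Automorphic BigHeckeGLn
open scoped NumberField
open IsDedekindDomain

variable {K : Type} [Field K] [NumberField K]

/-! ### The third level clause = hyperspecial at the good places -/

/-- `ι_v(g) ∈ GL₂(𝒪̂_K)` for `g ∈ GL₂(𝒪_v)`. [folklore] -/
theorem ofLocal_mem_glFiniteIntegralLevel {n : ℕ} (v : HeightOneSpectrum (𝓞 K))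
    {g : GL (Fin n) (v.adicCompletion K)}
    (hg : g ∈ valuedCongruenceSubgroup (Fin n) (1 : WithZero (Multiplicative ℤ))) :
    ofLocal n K v g ∈ glFiniteIntegralLevel n K := by
  refine mem_glFiniteIntegralLevel_iff_localComponent.2 fun w => ?_
  by_cases hw : w = v
  · subst hw
    rw [localComponent_ofLocal]
    exact hg
  · rw [localComponent_ofLocal_of_ne hw]
    exact one_mem _

/-- **The crux's third level clause makes the level hyperspecial at the good places**: if `U` contains
every `g ∈ GL_n(𝒪̂_K)` whose components at the bad places (those over `S₀`) are trivial, then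
`ι_v(GL_n(𝒪_v)) ≤ U` for every good `v`. [folklore] -/
theorem ofLocal_mem_of_goodClause {n : ℕ} (S₀ : Finset ℕ) {U : Subgroup (FiniteAdelicGL n K)}
    (hcl : ∀ g ∈ glFiniteIntegralLevel n K,
      (∀ w : HeightOneSpectrum (𝓞 K), ¬ (∀ ℓ ∈ S₀, ((ℓ : ℕ) : 𝓞 K) ∉ w.asIdeal) →
        ∀ i j : Fin n, ((g : Matrix (Fin n) (Fin n) (FiniteAdeleRing (𝓞 K) K)) i j) w =
          (1 : Matrix (Fin n) (Fin n) (w.adicCompletion K)) i j) → g ∈ U)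
    {v : HeightOneSpectrum (𝓞 K)} (hv : ∀ ℓ ∈ S₀, ((ℓ : ℕ) : 𝓞 K) ∉ v.asIdeal) :
    ∀ g ∈ valuedCongruenceSubgroup (Fin n) (1 : WithZero (Multiplicative ℤ)), ofLocal n K v g ∈ U := by
  intro g hg
  refine hcl _ (ofLocal_mem_glFiniteIntegralLevel v hg) fun w hw i j => ?_
  have hwv : w ≠ v := by
    rintro rfl
    exact hw hv
  rw [← coe_localComponent_apply, localComponent_ofLocal_of_ne hwv, Units.val_one]

/-! ### The levels `U ∩ K_f((2)^s)` of the crux's tower -/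

/-- `(2) ≠ 0` in `𝓞 K`. [folklore] -/
theorem span_two_ne_zero : (Ideal.span {((2 : ℕ) : 𝓞 K)} : Ideal (𝓞 K)) ≠ 0 := by
  rw [Ne, Ideal.zero_eq_bot, Ideal.span_singleton_eq_bot]
  exact Nat.cast_ne_zero.mpr two_ne_zero

omit [NumberField K] in
/-- A good place (for `S₀ ∋ 2`) divides no power of `(2)`. [folklore] -/
theorem not_dvd_span_two_pow {S₀ : Finset ℕ} (h2 : 2 ∈ S₀) {v : HeightOneSpectrum (𝓞 K)}
    (hv : ∀ ℓ ∈ S₀, ((ℓ : ℕ) : 𝓞 K) ∉ v.asIdeal) (s : ℕ) :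
    ¬ v.asIdeal ∣ (Ideal.span {((2 : ℕ) : 𝓞 K)} : Ideal (𝓞 K)) ^ s :=
  not_dvd_pow_of_not_le (fun h => hv 2 h2 ((Ideal.span_singleton_le_iff_mem _).1 h)) s

/-- **The levels of the crux's tower are unramified at the good places**: for `U ≤ GL₂(𝒪̂_K)`
hyperspecial at a good `v` (`2 ∈ S₀`), the `s`-th level `U ∩ K_f((2)^s)` of
`LevelTower.ofSeq U (K((2)^·).map sndHom)` satisfies `IsUnramifiedLevel GL_n(𝒪_v) ι_v (·)_v`.
[cite: ShimuraIATAF1971, Ch. 3, Prop. 3.1] -/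
theorem isUnramifiedLevel_cruxLevel {n : ℕ} {S₀ : Finset ℕ} (h2 : 2 ∈ S₀)
    {U : Subgroup (FiniteAdelicGL n K)} (hU : U ≤ glFiniteIntegralLevel n K)
    {v : HeightOneSpectrum (𝓞 K)} (hv : ∀ ℓ ∈ S₀, ((ℓ : ℕ) : 𝓞 K) ∉ v.asIdeal)
    (hhyp : ∀ g ∈ valuedCongruenceSubgroup (Fin n) (1 : WithZero (Multiplicative ℤ)),
      ofLocal n K v g ∈ U) (s : ℕ) :
    ArithmeticQuotient.IsUnramifiedLevel
      (valuedCongruenceSubgroup (Fin n) (1 : WithZero (Multiplicative ℤ))) (ofLocal n K v)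
      (localComponent n K v)
      ((LevelTower.ofSeq U fun r : ℕ =>
        (principalCongruenceLevel n K (Ideal.span {((2 : ℕ) : 𝓞 K)} ^ r)).map (GLn.sndHom n K)).level s) := by
  rw [ofSeq_comap_principalCongruenceLevel_pow_level span_two_ne_zero]
  exact isUnramifiedLevel_inf_comap_principalCongruenceLevel hU hhyp (pow_ne_zero s span_two_ne_zero)
    (not_dvd_span_two_pow h2 hv s)

/-- The levels `U ∩ K_f((2)^s)` are compact open for `U` open, `U ≤ GL₂(𝒪̂_K)`; hence all their double
cosets are finite. [cite: ShimuraIATAF1971, Ch. 3, Prop. 3.1] -/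
theorem finite_doubleCosetQuot_cruxLevel {n : ℕ} {U : Subgroup (FiniteAdelicGL n K)}
    (hUo : IsOpen (U : Set (FiniteAdelicGL n K))) (hU : U ≤ glFiniteIntegralLevel n K) (s : ℕ)
    (g : FiniteAdelicGL n K) :
    (ArithmeticQuotient.doubleCosetQuot
      ((LevelTower.ofSeq U fun r : ℕ =>
        (principalCongruenceLevel n K (Ideal.span {((2 : ℕ) : 𝓞 K)} ^ r)).map (GLn.sndHom n K)).level s)
      g).Finite := by
  have hUc : IsCompact (U : Set (FiniteAdelicGL n K)) :=
    (isCompact_glFiniteIntegralLevel_holds n K).of_isClosed_subset (Subgroup.isClosed_of_isOpen _ hUo) hU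
  rw [ofSeq_comap_principalCongruenceLevel_pow_level span_two_ne_zero]
  exact finite_doubleCosetQuot_of_isCompact_isOpen _
    (isCompact_inf_comap_principalCongruenceLevel hUc (pow_ne_zero s span_two_ne_zero))
    (isOpen_inf_comap_principalCongruenceLevel hUo (pow_ne_zero s span_two_ne_zero)) g

/-- **The indices along the tower are bounded by `[U : U']`**: for `U' ≤ U` with `U` compact and `U'`
open, `0 < [U ∩ K_f((2)^s) : U' ∩ K_f((2)^s)] ≤ [U : U'] < ∞` for every `s`. [folklore] -/
theorem relIndex_cruxLevel {n : ℕ} {U U' : Subgroup (FiniteAdelicGL n K)} (hle : U' ≤ U)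
    (hUc : IsCompact (U : Set (FiniteAdelicGL n K))) (hU'o : IsOpen (U' : Set (FiniteAdelicGL n K)))
    (s : ℕ) :
    ((LevelTower.ofSeq U' fun r : ℕ =>
        (principalCongruenceLevel n K (Ideal.span {((2 : ℕ) : 𝓞 K)} ^ r)).map (GLn.sndHom n K)).level s).relIndex
      ((LevelTower.ofSeq U fun r : ℕ =>
        (principalCongruenceLevel n K (Ideal.span {((2 : ℕ) : 𝓞 K)} ^ r)).map (GLn.sndHom n K)).level s) ≠ 0 ∧
    ((LevelTower.ofSeq U' fun r : ℕ =>
        (principalCongruenceLevel n K (Ideal.span {((2 : ℕ) : 𝓞 K)} ^ r)).map (GLn.sndHom n K)).level s).relIndex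
      ((LevelTower.ofSeq U fun r : ℕ =>
        (principalCongruenceLevel n K (Ideal.span {((2 : ℕ) : 𝓞 K)} ^ r)).map (GLn.sndHom n K)).level s) ≤
      U'.relIndex U := by
  have hD : U'.relIndex U ≠ 0 := (Subgroup.finiteIndex_subgroupOf_of_isCompact_isOpen hUc hU'o).index_ne_zero
  rw [ofSeq_comap_principalCongruenceLevel_pow_level span_two_ne_zero,
    ofSeq_comap_principalCongruenceLevel_pow_level span_two_ne_zero]
  set Ks := (principalCongruenceLevel n K (Ideal.span {((2 : ℕ) : 𝓞 K)} ^ s)).comap (GLn.ofFinite n K)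
  have hinf : U' ⊓ Ks = U' ⊓ (U ⊓ Ks) := by
    rw [← inf_assoc, inf_eq_left.2 hle]
  rw [hinf, Subgroup.inf_relIndex_right]
  have hle' : U ⊓ Ks ≤ U := inf_le_left
  exact ⟨fun h => hD (Subgroup.relIndex_eq_zero_of_le_right hle' h),
    Subgroup.relIndex_le_of_le_right hle' hD⟩

/-! ### Tame-level monotonicity of Hecke points, in the crux's vocabulary -/

/-- **Points of `Spf 𝕋(U²)` are points of `Spf 𝕋(U'²)` for every open `U' ≤ U` hyperspecial at the good
places** (registered sub-goal; the crux's literal `Γ = GL₂(K) → GL₂(𝔸_K^∞)`, towers `U ∩ K((2)^s)`,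
Hecke family `(v,i) ↦ (t_{v,i+1})_f` over the good places, `k = ℤ̄₂`, `ϖ = 2`).  Hypotheses: `2 ∈ S₀`;
`U' ≤ U`, both open, `U ≤ GL₂(𝒪̂_K)`, and `U'` satisfies the crux's third level clause.  Proof:
`crux_isHeckePoint_of_subtower_finiteIndex` with `D = [U : U']`, the compatibilities supplied by
`isUnramifiedLevel_cruxLevel`, `finite_doubleCosetQuot_cruxLevel`, `relIndex_cruxLevel`.  So in the
conclusion of B and of the crux the tame level can always be shrunk — along even-index steps and at the
places over `2` as well as along odd-index steps. [cite: ShimuraIATAF1971, Ch. 3, Prop. 3.1]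
[cite: Brown1982CohomologyGroups, Ch. III, Prop. 9.5 (ii), Prop. 10.1] -/
theorem crux_isHeckePoint_of_le_tameLevel : ∀ (K : Type) [Field K] [NumberField K] (S₀ : Finset ℕ),
    2 ∈ S₀ →
    ∀ (ϖ : ∀ v : HeightOneSpectrum (𝓞 K), (v.adicCompletion K)ˣ)
      (a : {v : HeightOneSpectrum (𝓞 K) // ∀ ℓ ∈ S₀, ((ℓ : ℕ) : 𝓞 K) ∉ v.asIdeal} → ℕ →
        (PadicAlgCl.valued 2).v.valuationSubring)
      (U U' : Subgroup (GL (Fin 2) (FiniteAdeleRing (𝓞 K) K))),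
    U' ≤ U → IsOpen (U : Set (GL (Fin 2) (FiniteAdeleRing (𝓞 K) K))) →
    IsOpen (U' : Set (GL (Fin 2) (FiniteAdeleRing (𝓞 K) K))) → U ≤ glFiniteIntegralLevel 2 K →
    (∀ g ∈ glFiniteIntegralLevel 2 K,
      (∀ v : HeightOneSpectrum (𝓞 K), ¬ (∀ ℓ ∈ S₀, ((ℓ : ℕ) : 𝓞 K) ∉ v.asIdeal) →
        ∀ i j : Fin 2, ((g : Matrix (Fin 2) (Fin 2) (FiniteAdeleRing (𝓞 K) K)) i j) v =
          (1 : Matrix (Fin 2) (Fin 2) (v.adicCompletion K)) i j) → g ∈ U') →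
    IsHeckePoint
      (Matrix.GeneralLinearGroup.map (algebraMap K (FiniteAdeleRing (𝓞 K) K)) :
        GL (Fin 2) K →* GL (Fin 2) (FiniteAdeleRing (𝓞 K) K))
      (LevelTower.ofSeq U (fun r : ℕ =>
        (principalCongruenceLevel 2 K (Ideal.span {((2 : ℕ) : 𝓞 K)} ^ r)).map (GLn.sndHom 2 K)))
      ((2 : ℕ) : (PadicAlgCl.valued 2).v.valuationSubring)
      (fun j : {v : HeightOneSpectrum (𝓞 K) // ∀ ℓ ∈ S₀, ((ℓ : ℕ) : 𝓞 K) ∉ v.asIdeal} × Fin 2 =>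
        GLn.sndHom 2 K (heckeDiagAt 2 K j.1.1 (ϖ j.1.1) (j.2.val + 1)))
      (fun j => a j.1 (j.2.val + 1)) →
    IsHeckePoint
      (Matrix.GeneralLinearGroup.map (algebraMap K (FiniteAdeleRing (𝓞 K) K)) :
        GL (Fin 2) K →* GL (Fin 2) (FiniteAdeleRing (𝓞 K) K))
      (LevelTower.ofSeq U' (fun r : ℕ =>
        (principalCongruenceLevel 2 K (Ideal.span {((2 : ℕ) : 𝓞 K)} ^ r)).map (GLn.sndHom 2 K)))
      ((2 : ℕ) : (PadicAlgCl.valued 2).v.valuationSubring)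
      (fun j : {v : HeightOneSpectrum (𝓞 K) // ∀ ℓ ∈ S₀, ((ℓ : ℕ) : 𝓞 K) ∉ v.asIdeal} × Fin 2 =>
        GLn.sndHom 2 K (heckeDiagAt 2 K j.1.1 (ϖ j.1.1) (j.2.val + 1)))
      (fun j => a j.1 (j.2.val + 1)) := by
  intro K _ _ S₀ h2 ϖ a U U' hle hUo hU'o hU hcl hpt
  have hU' : U' ≤ glFiniteIntegralLevel 2 K := hle.trans hU
  have hUc : IsCompact (U : Set (FiniteAdelicGL 2 K)) :=
    (isCompact_glFiniteIntegralLevel_holds 2 K).of_isClosed_subset (Subgroup.isClosed_of_isOpen _ hUo) hU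
  have hhyp' : ∀ v : HeightOneSpectrum (𝓞 K), (∀ ℓ ∈ S₀, ((ℓ : ℕ) : 𝓞 K) ∉ v.asIdeal) →
      ∀ g ∈ valuedCongruenceSubgroup (Fin 2) (1 : WithZero (Multiplicative ℤ)), ofLocal 2 K v g ∈ U' :=
    fun v hv => ofLocal_mem_of_goodClause S₀ hcl hv
  have hhyp : ∀ v : HeightOneSpectrum (𝓞 K), (∀ ℓ ∈ S₀, ((ℓ : ℕ) : 𝓞 K) ∉ v.asIdeal) →
      ∀ g ∈ valuedCongruenceSubgroup (Fin 2) (1 : WithZero (Multiplicative ℤ)), ofLocal 2 K v g ∈ U :=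
    fun v hv g hg => hle (hhyp' v hv g hg)
  -- the good double cosets of the two towers correspond (both levels unramified at the good places)
  have hbij : ∀ (s : ℕ) (j : {v : HeightOneSpectrum (𝓞 K) // ∀ ℓ ∈ S₀, ((ℓ : ℕ) : 𝓞 K) ∉ v.asIdeal} × Fin 2),
      Set.BijOn (Subgroup.quotientMapOfLE (ofSeq_level_mono hle (fun r : ℕ =>
          (principalCongruenceLevel 2 K (Ideal.span {((2 : ℕ) : 𝓞 K)} ^ r)).map (GLn.sndHom 2 K)) s))
        (ArithmeticQuotient.doubleCosetQuot
          ((LevelTower.ofSeq U' fun r : ℕ =>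
            (principalCongruenceLevel 2 K (Ideal.span {((2 : ℕ) : 𝓞 K)} ^ r)).map (GLn.sndHom 2 K)).level s)
          (GLn.sndHom 2 K (heckeDiagAt 2 K j.1.1 (ϖ j.1.1) (j.2.val + 1))))
        (ArithmeticQuotient.doubleCosetQuot
          ((LevelTower.ofSeq U fun r : ℕ =>
            (principalCongruenceLevel 2 K (Ideal.span {((2 : ℕ) : 𝓞 K)} ^ r)).map (GLn.sndHom 2 K)).level s)
          (GLn.sndHom 2 K (heckeDiagAt 2 K j.1.1 (ϖ j.1.1) (j.2.val + 1)))) := by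
    intro s j
    rw [sndHom_heckeDiagAt_eq_ofLocal]
    exact (isUnramifiedLevel_cruxLevel h2 hU j.1.2 (hhyp j.1.1 j.1.2) s).bijOn_quotientMapOfLE
      (ofSeq_level_mono hle _ s) (isUnramifiedLevel_cruxLevel h2 hU' j.1.2 (hhyp' j.1.1 j.1.2) s) _
  -- the good double cosets are finite (compact open levels)
  have hfin : ∀ (s : ℕ) (j : {v : HeightOneSpectrum (𝓞 K) // ∀ ℓ ∈ S₀, ((ℓ : ℕ) : 𝓞 K) ∉ v.asIdeal} × Fin 2),
      (ArithmeticQuotient.doubleCosetQuot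
        ((LevelTower.ofSeq U fun r : ℕ =>
          (principalCongruenceLevel 2 K (Ideal.span {((2 : ℕ) : 𝓞 K)} ^ r)).map (GLn.sndHom 2 K)).level s)
        (GLn.sndHom 2 K (heckeDiagAt 2 K j.1.1 (ϖ j.1.1) (j.2.val + 1)))).Finite :=
    fun s j => finite_doubleCosetQuot_cruxLevel hUo hU s _
  have hidx : ∀ s : ℕ,
      ((LevelTower.ofSeq U' fun r : ℕ =>
          (principalCongruenceLevel 2 K (Ideal.span {((2 : ℕ) : 𝓞 K)} ^ r)).map (GLn.sndHom 2 K)).level s).relIndex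
        ((LevelTower.ofSeq U fun r : ℕ =>
          (principalCongruenceLevel 2 K (Ideal.span {((2 : ℕ) : 𝓞 K)} ^ r)).map (GLn.sndHom 2 K)).level s) ≠ 0 ∧
      ((LevelTower.ofSeq U' fun r : ℕ =>
          (principalCongruenceLevel 2 K (Ideal.span {((2 : ℕ) : 𝓞 K)} ^ r)).map (GLn.sndHom 2 K)).level s).relIndex
        ((LevelTower.ofSeq U fun r : ℕ =>
          (principalCongruenceLevel 2 K (Ideal.span {((2 : ℕ) : 𝓞 K)} ^ r)).map (GLn.sndHom 2 K)).level s) ≤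
        U'.relIndex U :=
    relIndex_cruxLevel hle hUc hU'o
  exact crux_isHeckePoint_of_subtower_finiteIndex K
    (LevelTower.ofSeq U fun r : ℕ =>
      (principalCongruenceLevel 2 K (Ideal.span {((2 : ℕ) : 𝓞 K)} ^ r)).map (GLn.sndHom 2 K))
    (LevelTower.ofSeq U' fun r : ℕ =>
      (principalCongruenceLevel 2 K (Ideal.span {((2 : ℕ) : 𝓞 K)} ^ r)).map (GLn.sndHom 2 K))
    (ofSeq_level_mono hle _) {v : HeightOneSpectrum (𝓞 K) // ∀ ℓ ∈ S₀, ((ℓ : ℕ) : 𝓞 K) ∉ v.asIdeal}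
    (fun v => v.1) ϖ a (U'.relIndex U) hbij hfin hidx hpt

/-! ### Corollary for stub B: its conclusion block is stable under intersecting the level -/

/-- **The conclusion of stub B (and of the crux, for fixed `ϖ, a`) at level `U` implies the same
conclusion at level `U ∩ V` for every open `V` satisfying the third level clause** (registered
sub-goal).  The block is, verbatim: `U` open, `U ≤ GL₂(𝒪̂_K)`, `U ⊇ {g ∈ GL₂(𝒪̂_K) : g_w = 1 at the bad w}`,
and `a` a point of `Spf 𝕋(U²)`.  Hence "∃ U free over `S₀`" in B / E2′ may be read "for SOME — equivalently
for some arbitrarily small — tame level": below the level `U₀` of B's hypothesis (take `V = U₀`), inside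
`K_f(𝔫)` for any `𝔫` supported over `S₀` (take `V = U₀ ∩ K_f(𝔫)`), etc.; B is big `R = 𝕋_𝔪` at a fixed,
sufficiently small tame level read at the Artin point, with no level-lowering content hidden in `∃ U`.
[cite: ShimuraIATAF1971, Ch. 3, Prop. 3.1] [cite: Brown1982CohomologyGroups, Ch. III, Prop. 10.1] -/
theorem artinLift_conclusion_inf : ∀ (K : Type) [Field K] [NumberField K] (S₀ : Finset ℕ), 2 ∈ S₀ →
    ∀ (ϖ : ∀ v : HeightOneSpectrum (𝓞 K), (v.adicCompletion K)ˣ)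
      (a : {v : HeightOneSpectrum (𝓞 K) // ∀ ℓ ∈ S₀, ((ℓ : ℕ) : 𝓞 K) ∉ v.asIdeal} → ℕ →
        (PadicAlgCl.valued 2).v.valuationSubring)
      (U V : Subgroup (GL (Fin 2) (FiniteAdeleRing (𝓞 K) K))),
    (IsOpen (U : Set (GL (Fin 2) (FiniteAdeleRing (𝓞 K) K))) ∧
      U ≤ glFiniteIntegralLevel 2 K ∧
      (∀ g ∈ glFiniteIntegralLevel 2 K,
        (∀ v : HeightOneSpectrum (𝓞 K), ¬ (∀ ℓ ∈ S₀, ((ℓ : ℕ) : 𝓞 K) ∉ v.asIdeal) →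
          ∀ i j : Fin 2, ((g : Matrix (Fin 2) (Fin 2) (FiniteAdeleRing (𝓞 K) K)) i j) v =
            (1 : Matrix (Fin 2) (Fin 2) (v.adicCompletion K)) i j) → g ∈ U) ∧
      IsHeckePoint
        (Matrix.GeneralLinearGroup.map (algebraMap K (FiniteAdeleRing (𝓞 K) K)) :
          GL (Fin 2) K →* GL (Fin 2) (FiniteAdeleRing (𝓞 K) K))
        (LevelTower.ofSeq U (fun r : ℕ =>
          (principalCongruenceLevel 2 K (Ideal.span {((2 : ℕ) : 𝓞 K)} ^ r)).map (GLn.sndHom 2 K)))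
        ((2 : ℕ) : (PadicAlgCl.valued 2).v.valuationSubring)
        (fun j : {v : HeightOneSpectrum (𝓞 K) // ∀ ℓ ∈ S₀, ((ℓ : ℕ) : 𝓞 K) ∉ v.asIdeal} × Fin 2 =>
          GLn.sndHom 2 K (heckeDiagAt 2 K j.1.1 (ϖ j.1.1) (j.2.val + 1)))
        (fun j => a j.1 (j.2.val + 1))) →
    IsOpen (V : Set (GL (Fin 2) (FiniteAdeleRing (𝓞 K) K))) →
    (∀ g ∈ glFiniteIntegralLevel 2 K,
      (∀ v : HeightOneSpectrum (𝓞 K), ¬ (∀ ℓ ∈ S₀, ((ℓ : ℕ) : 𝓞 K) ∉ v.asIdeal) →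
        ∀ i j : Fin 2, ((g : Matrix (Fin 2) (Fin 2) (FiniteAdeleRing (𝓞 K) K)) i j) v =
          (1 : Matrix (Fin 2) (Fin 2) (v.adicCompletion K)) i j) → g ∈ V) →
    (IsOpen (((U ⊓ V : Subgroup (GL (Fin 2) (FiniteAdeleRing (𝓞 K) K))) :
        Set (GL (Fin 2) (FiniteAdeleRing (𝓞 K) K)))) ∧
      U ⊓ V ≤ glFiniteIntegralLevel 2 K ∧
      (∀ g ∈ glFiniteIntegralLevel 2 K,
        (∀ v : HeightOneSpectrum (𝓞 K), ¬ (∀ ℓ ∈ S₀, ((ℓ : ℕ) : 𝓞 K) ∉ v.asIdeal) →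
          ∀ i j : Fin 2, ((g : Matrix (Fin 2) (Fin 2) (FiniteAdeleRing (𝓞 K) K)) i j) v =
            (1 : Matrix (Fin 2) (Fin 2) (v.adicCompletion K)) i j) → g ∈ U ⊓ V) ∧
      IsHeckePoint
        (Matrix.GeneralLinearGroup.map (algebraMap K (FiniteAdeleRing (𝓞 K) K)) :
          GL (Fin 2) K →* GL (Fin 2) (FiniteAdeleRing (𝓞 K) K))
        (LevelTower.ofSeq (U ⊓ V) (fun r : ℕ =>
          (principalCongruenceLevel 2 K (Ideal.span {((2 : ℕ) : 𝓞 K)} ^ r)).map (GLn.sndHom 2 K)))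
        ((2 : ℕ) : (PadicAlgCl.valued 2).v.valuationSubring)
        (fun j : {v : HeightOneSpectrum (𝓞 K) // ∀ ℓ ∈ S₀, ((ℓ : ℕ) : 𝓞 K) ∉ v.asIdeal} × Fin 2 =>
          GLn.sndHom 2 K (heckeDiagAt 2 K j.1.1 (ϖ j.1.1) (j.2.val + 1)))
        (fun j => a j.1 (j.2.val + 1))) := by
  intro K _ _ S₀ h2 ϖ a U V hU hVo hclV
  obtain ⟨hUo, hUint, hclU, hpt⟩ := hU
  have hUVo : IsOpen (((U ⊓ V : Subgroup (GL (Fin 2) (FiniteAdeleRing (𝓞 K) K))) :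
      Set (GL (Fin 2) (FiniteAdeleRing (𝓞 K) K)))) := by
    rw [Subgroup.coe_inf]
    exact hUo.inter hVo
  have hclUV : ∀ g ∈ glFiniteIntegralLevel 2 K,
      (∀ v : HeightOneSpectrum (𝓞 K), ¬ (∀ ℓ ∈ S₀, ((ℓ : ℕ) : 𝓞 K) ∉ v.asIdeal) →
        ∀ i j : Fin 2, ((g : Matrix (Fin 2) (Fin 2) (FiniteAdeleRing (𝓞 K) K)) i j) v =
          (1 : Matrix (Fin 2) (Fin 2) (v.adicCompletion K)) i j) → g ∈ U ⊓ V :=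
    fun g hg hgS => ⟨hclU g hg hgS, hclV g hg hgS⟩
  exact ⟨hUVo, inf_le_left.trans hUint, hclUV,
    crux_isHeckePoint_of_le_tameLevel K S₀ h2 ϖ a U (U ⊓ V) inf_le_left hUo hUVo hUint hclUV hpt⟩

end Summit.Langlands.Langlands.Theorems.TwoAdicBianchiProModularityLevel

end
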